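import Summits.ValiantsHypothesis.ValiantsHypothesis.Theses.LangWeilTransfer
import Summits.ValiantsHypothesis.ValiantsHypothesis.Theorems.GaugeDescentScalarRestriction

/-!
# LangWeilTransfer, support item `ScalarRestriction` (stmt-ValiantsHypothesis-6380) — PROVED

Route `LangWeilTransfer` of `ValiantsHypothesis`, support item `ScalarRestriction`: **Weil restriction
of scalars for circuits** — a fan-in-two circuit over `GaloisField p r` computing (the image of)
`f ∈ 𝔽_p[x_σ]` yields a fan-in-two circuit over `ZMod p` computing `f`, of size
`≤ A (r+1)³ (|P| + 1)` for an absolute constant `A`.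

Proof: this is the circuit form of the sibling item `GaugeDescent.ScalarRestriction`
(`L_F(f) ≤ c [E:F]³ L_E(f)`, tree `…Theorems.GaugeDescent.scalarRestriction_proof`, itself a
corollary of the Hrubeš–Yehudayoff structure-constant simulation `CommExtSim.complexity_lmap_le`):
`L_E(f) ≤ |P|` for any fan-in-two circuit computing `f ⊗ E`, an optimal circuit realises `L_F(f)`,
and `[GaloisField p r : 𝔽_p] ≤ r + 1` (`= r` for `r ≠ 0`; the degenerate `GaloisField p 0`, the
splitting field of the zero polynomial, is `𝔽_p` itself). Honest framing: bookkeeping inside a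
dormant route; nothing here bears on VP ≠ VNP.
-/

noncomputable section

open MvPolynomial

-- the summit and the problem share the name `ValiantsHypothesis` (D-0017 single-conjunct layout)
set_option linter.dupNamespace false

namespace Summit.ValiantsHypothesis.ValiantsHypothesis.Theorems.LangWeilTransfer

open Literature.Computability.AlgebraicComplexity

/-- `[GaloisField p r : 𝔽_p] ≤ r + 1` (equality `= r` for `r ≠ 0`; for `r = 0` the Galois field is
the splitting field of the zero polynomial, i.e. `𝔽_p`). -/
theorem finrank_galoisField_le (p : ℕ) [Fact p.Prime] (r : ℕ) :
    Module.finrank (ZMod p) (GaloisField p r) ≤ r + 1 := by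
  rcases eq_or_ne r 0 with rfl | hr
  · have h : Algebra.adjoin (ZMod p)
        ((Polynomial.X ^ p ^ 0 - Polynomial.X : Polynomial (ZMod p)).rootSet (GaloisField p 0)) =
          ⊤ := by
      dsimp only [GaloisField]
      exact Polynomial.SplittingField.adjoin_rootSet _
    have h0 : (Polynomial.X ^ p ^ 0 - Polynomial.X : Polynomial (ZMod p)) = 0 := by
      rw [pow_zero, pow_one, sub_self]
    rw [h0, Polynomial.rootSet_zero, Algebra.adjoin_empty] at h
    rw [Subalgebra.bot_eq_top_iff_finrank_eq_one.1 h]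
  · rw [GaloisField.finrank p hr]
    exact Nat.le_succ r

/-- **Item `ScalarRestriction` (route `LangWeilTransfer`) holds.** -/
theorem scalarRestriction_proof :
    Summit.ValiantsHypothesis.ValiantsHypothesis.Theses.LangWeilTransfer.ScalarRestriction := by
  unfold Summit.ValiantsHypothesis.ValiantsHypothesis.Theses.LangWeilTransfer.ScalarRestriction
  have hsr := Summit.ValiantsHypothesis.ValiantsHypothesis.Theorems.GaugeDescent.scalarRestriction_proof
  unfold Summit.ValiantsHypothesis.ValiantsHypothesis.Theses.GaugeDescent.ScalarRestriction at hsr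
  obtain ⟨c, hc⟩ := hsr
  refine ⟨c, ?_⟩
  intro p _ r σ f P hP1 hP2
  obtain ⟨P', h1, h2, h3⟩ := ArithCircuit.exists_computes_size_eq_complexity f
  refine ⟨P', h1, h2, ?_⟩
  rw [h3]
  refine (hc (ZMod p) (GaloisField p r) σ f).trans ?_
  have hL : complexity (MvPolynomial.map (algebraMap (ZMod p) (GaloisField p r)) f) ≤ P.size + 1 :=
    (ArithCircuit.complexity_le_size hP1 hP2).trans (Nat.le_succ _)
  have hd : Module.finrank (ZMod p) (GaloisField p r) ^ 3 ≤ (r + 1) ^ 3 :=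
    Nat.pow_le_pow_left (finrank_galoisField_le p r) 3
  exact Nat.mul_le_mul (Nat.mul_le_mul_left _ hd) hL

end Summit.ValiantsHypothesis.ValiantsHypothesis.Theorems.LangWeilTransfer

end
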